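import Summits.QuantumFields.YangMills.Theorems.FluctuationComparisonRegPrIntLS2BetaChartJacPinningAE
import Summits.QuantumFields.YangMills.Theorems.FluctuationComparisonRegPrIntLS2BetaChartJacPinningPoint
import HarnessLib

/-!
# S2β · LINE g18-1 · DET-REP-B‴∘ ∕ JACW — (J-PIN) closing piece: THE POINT ROWS OF THE TRANSPORTED EXPLICIT DENSITY, AND THE KNIT
# «any window chart with the rows has, at every charted small-field history, the Jacobian value of the explicit fibred chart»

Cell `ym3-torus` (rung R3: continuum `SU(2)` Yang–Mills on `T³` — NOT `d = 4`, NOT infinite volume, NOT a mass gap, NOT Clay); width seat `ym-ust-20520-w5` g16;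
helper of the crux `stmt-QuantumFields-20520` (`--supports … --as helper`, NOT a proof of it).  Road (R1) of FINDING #41 §3, item (P-close)(i) of its addendum.

THE POINT.  ✓brick 3 (`…ChartJacPinningPoint.windowChart_jac_eq_at_local`) upgrades the a.e. identification `c.jac =ᵐ G′` (✓brick 2) to the POINT `(V₀, U)` given two
continuity rows of the reference density `G′` there.  For the reference of interest — the fibred chart `(Φ, Jac, T)` of the iterated averaging (✓IV-c ∕ ✓p761834, whose
`Jac` IS the product `1_{windows}·Π_c jd c z (V c)`) carried to the window level by ✓`…WregFibredChart.fibredLaw_transport`, i.e. `G′ (V, z) = 1_S(Φ (e′V, z))·Jac (e′V, z)`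
with `e′ = fieldShift hs.symm` — §1 DERIVES those two rows, at every charted point `U ∈ S` of strict small history with `Ū⁽ᴷ⁻ᴶ⁾ U = e′ V₀`, from ✓IV-c's own conjuncts IN THEIR
LETTERS (abstract over the chart data, no regime constants): (6) live ↔ windows, (7) continuity at all-interior coarse points, (9) closed windows, the EDGE null row
«`v ∉ frontier (T c z)` for a.e. `z`» (✓`…Wreg.edgeFlat` after (9)'s `T = chainMap '' chainWindow`), (20) the TRANSFER (continuity within the window graph at charted
strict points), the window-graph neighbourhood (✓`…ChartContCarrierNhds.graph_mem_nhds`), recognition (12) at `U`, and `S` open.  §2 KNITS: ✓brick 2 `ae_eq_of_two_laws` on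
`c.map_Φ` versus the transported law (hypothesis `hlaw′`, = ✓`fibredLaw_transport`'s conclusion) + ✓brick 3 (local) + §1 ⟹
★★★`windowChart_jac_eq_explicit_at : (c.jac (V₀, U) : ℝ≥0∞) = Jac (e′ V₀, U)` for EVERY `c : WindowChart F hJK S O` with the `ChartRows`∕`ChartRowsJ` clauses — and
`Jac (e′V₀, U) = Π_c jd c U ((e′V₀) c)` by ✓p761834 `jac_apply_eq_prod_of_mem`.  What the JACW hand then owes is ONLY (J-LIP)∘(J-BRD) (print's Thm 1 (9)) into ✓p761050.
HONEST SCOPE.  Point-set ∕ measure bookkeeping over landed theorems; def-free; default heartbeats; proves nothing of BRD, DETN∕JACW's value bound, DET-REP-B‴∘, S2β or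
the crux 20520; `YM3TorusSU2` NOT proved; the Yang–Mills mass gap (Clay) NOT proved.
[cite: Balaban1987RG1, (0.4) p.253 and (2.10) p.267] [cite: Bogachev2007, Thm 2.5.3]
-/

set_option autoImplicit false

noncomputable section

open MeasureTheory Filter Topology Set Function
open scoped ENNReal NNReal
open Literature.MathematicalPhysics.QuantumFieldTheory.Balaban1983to89
open Literature.MathematicalPhysics.QuantumFieldTheory.Balaban1983to89.T3ContinuumYM3Torus
open Literature.MathematicalPhysics.QuantumFieldTheory.Balaban1983to89.T3NestedUnitLaws
open Literature.MathematicalPhysics.QuantumFieldTheory.Balaban1983to89.T3UnitLawDensityEML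
open Literature.MathematicalPhysics.QuantumFieldTheory.Balaban1983to89.T3UnitScaleTilt
open Literature.MathematicalPhysics.QuantumFieldTheory.Balaban1983to89.T3TiltDescent
open Literature.MathematicalPhysics.QuantumFieldTheory.Balaban1983to89.T3LevelShift
open Literature.MathematicalPhysics.QuantumFieldTheory.Balaban1983to89.T4Continuum
open scoped Literature.MathematicalPhysics.QuantumFieldTheory.Balaban1983to89.T3OrbitAverage

namespace Summit.QuantumFields.YangMills.Theorems.FluctuationComparisonRegPrIntLS2BetaChartJacExplicitPointRows

open Summit.QuantumFields.YangMills.Theorems.FluctuationComparisonRegPrIntLS2BetaChartJacPinningAE (ae_eq_of_two_laws)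
open Summit.QuantumFields.YangMills.Theorems.FluctuationComparisonRegPrIntLS2BetaChartJacPinningPoint (windowChart_jac_eq_at_local)

variable (F : T3Family) {J K : ℕ} (hJK : J ≤ K)

/-! ## §1 The point rows of the transported explicit density, from ✓IV-c's conjuncts in their letters -/

/-- ★★ **THE TWO POINT ROWS OF `G′ = 1_S(Φ(e′V,z))·Jac(e′V,z)` AT A CHARTED STRICT POINT.**  Abstract over fibred-chart data `(Φ, Jac, T)` on
`GaugeField (F.P K) (K−J) × GaugeField (F.P K) 0` with: live ↔ windows (`hJT`), continuity at all-interior coarse points (`hreg`), closed windows, the EDGE null row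
(`hedge`: every `v` is a.e. off the frontier of `T c ·`), the TRANSFER (`htransfer`), the window-graph neighbourhood (`hgraph`); a level identification `hs` (`e′ := fieldShift
hs.symm`, continuous); `S` open inside the strict small-history set; and a point `U ∈ S` with `Ū⁽ᴷ⁻ᴶ⁾ U = e′ V₀`, live and self-charted (`Jac (e′V₀, U) ≠ 0`, `Φ (e′V₀, U) = U` —
recognition).  THEN with `N := {z | Jac (e′V₀, z) ≠ 0 ∧ Φ (e′V₀, z) ∈ S}`: (1) `N ∈ 𝓝 U`; (2) for a.e. `z`, `z ∈ N →` `G′ (·, z)` is continuous at `V₀`; (3) `G′ (V₀, ·)` is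
continuous at `U`. [cite: Balaban1987RG1, (0.4) p.253 and (2.10) p.267] -/
theorem explicit_pointRows
    {Φ : GaugeField (F.P K) (K - J) (Matrix.specialUnitaryGroup (Fin 2) ℂ) × GaugeField (F.P K) 0 (Matrix.specialUnitaryGroup (Fin 2) ℂ) →
      GaugeField (F.P K) 0 (Matrix.specialUnitaryGroup (Fin 2) ℂ)}
    {Jac : GaugeField (F.P K) (K - J) (Matrix.specialUnitaryGroup (Fin 2) ℂ) × GaugeField (F.P K) 0 (Matrix.specialUnitaryGroup (Fin 2) ℂ) → ℝ≥0}
    {T : PBond (F.P K) (K - J) → GaugeField (F.P K) 0 (Matrix.specialUnitaryGroup (Fin 2) ℂ) → Set (Matrix.specialUnitaryGroup (Fin 2) ℂ)}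
    (hJT : ∀ V z, Jac (V, z) ≠ 0 ↔ ∀ c, V c ∈ T c z)
    (hreg : ∀ V₀ z, (∀ c, V₀ c ∈ interior (T c z)) → ContinuousAt (fun V => Φ (V, z)) V₀ ∧ ContinuousAt (fun V => Jac (V, z)) V₀)
    (hedge : ∀ c (v : Matrix.specialUnitaryGroup (Fin 2) ℂ), ∀ᵐ z ∂fieldMeasure (F.P K) 0 (Matrix.specialUnitaryGroup (Fin 2) ℂ), v ∉ frontier (T c z))
    {Strict : Set (GaugeField (F.P K) 0 (Matrix.specialUnitaryGroup (Fin 2) ℂ))}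
    (htransfer : ∀ (V : GaugeField (F.P K) (K - J) (Matrix.specialUnitaryGroup (Fin 2) ℂ)) (z₀ : GaugeField (F.P K) 0 (Matrix.specialUnitaryGroup (Fin 2) ℂ)),
      (∀ c, V c ∈ T c z₀) → Φ (V, z₀) ∈ Strict →
        ContinuousWithinAt Φ {p : GaugeField (F.P K) (K - J) (Matrix.specialUnitaryGroup (Fin 2) ℂ) × GaugeField (F.P K) 0 (Matrix.specialUnitaryGroup (Fin 2) ℂ) |
            ∀ c, p.1 c ∈ T c p.2} (V, z₀) ∧
        ContinuousWithinAt Jac {p : GaugeField (F.P K) (K - J) (Matrix.specialUnitaryGroup (Fin 2) ℂ) × GaugeField (F.P K) 0 (Matrix.specialUnitaryGroup (Fin 2) ℂ) |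
            ∀ c, p.1 c ∈ T c p.2} (V, z₀))
    (hgraph : ∀ U₀ : GaugeField (F.P K) 0 (Matrix.specialUnitaryGroup (Fin 2) ℂ), U₀ ∈ Strict →
      {z : GaugeField (F.P K) 0 (Matrix.specialUnitaryGroup (Fin 2) ℂ) | ∀ c,
        Averaging.iter (fun i => BlockAveraging.blockAvg (P := F.P K) (j := i) ℰp) (K - J) U₀ c ∈ T c z} ∈ 𝓝 U₀)
    (hs : (F.PP F.m J).sitesPerDir 0 = (F.PP F.m K).sitesPerDir (K - J))
    {S : Set (GaugeField (F.P K) 0 (Matrix.specialUnitaryGroup (Fin 2) ℂ))} (hSo : IsOpen S) (hSstrict : S ⊆ Strict)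
    {V₀ : GaugeField (F.P J) 0 (Matrix.specialUnitaryGroup (Fin 2) ℂ)} {U : GaugeField (F.P K) 0 (Matrix.specialUnitaryGroup (Fin 2) ℂ)} (hUS : U ∈ S)
    (hUV : Averaging.iter (fun i => BlockAveraging.blockAvg (P := F.P K) (j := i) ℰp) (K - J) U = fieldShift hs.symm V₀)
    (hJU : Jac (fieldShift hs.symm V₀, U) ≠ 0) (hΦU : Φ (fieldShift hs.symm V₀, U) = U) :
    {z | Jac (fieldShift hs.symm V₀, z) ≠ 0 ∧ Φ (fieldShift hs.symm V₀, z) ∈ S} ∈ 𝓝 U ∧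
    (∀ᵐ z ∂fieldMeasure (F.P K) 0 (Matrix.specialUnitaryGroup (Fin 2) ℂ), z ∈ {z | Jac (fieldShift hs.symm V₀, z) ≠ 0 ∧ Φ (fieldShift hs.symm V₀, z) ∈ S} →
      ContinuousAt (fun V : GaugeField (F.P J) 0 (Matrix.specialUnitaryGroup (Fin 2) ℂ) =>
        S.indicator (1 : GaugeField (F.P K) 0 (Matrix.specialUnitaryGroup (Fin 2) ℂ) → ℝ≥0∞) (Φ (fieldShift hs.symm V, z)) * (Jac (fieldShift hs.symm V, z) : ℝ≥0∞)) V₀) ∧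
    ContinuousAt (fun z => S.indicator (1 : GaugeField (F.P K) 0 (Matrix.specialUnitaryGroup (Fin 2) ℂ) → ℝ≥0∞) (Φ (fieldShift hs.symm V₀, z)) *
      (Jac (fieldShift hs.symm V₀, z) : ℝ≥0∞)) U := by
  set e' : GaugeField (F.P J) 0 (Matrix.specialUnitaryGroup (Fin 2) ℂ) → GaugeField (F.P K) (K - J) (Matrix.specialUnitaryGroup (Fin 2) ℂ) :=
    fieldShift hs.symm with he'_def
  have he'c : Continuous e' := continuous_pi fun c => continuous_apply (bondShift hs.symm c)
  have hUstrict : U ∈ Strict := hSstrict hUS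
  have hVU : ∀ c, (e' V₀) c ∈ T c U := (hJT _ _).1 hJU
  -- the window-graph slice at `e′ V₀` is a neighbourhood of `U`
  have hG : {z : GaugeField (F.P K) 0 (Matrix.specialUnitaryGroup (Fin 2) ℂ) | ∀ c, (e' V₀) c ∈ T c z} ∈ 𝓝 U := by
    have h := hgraph U hUstrict
    rwa [hUV] at h
  -- continuity of `Φ (e′V₀, ·)` and `Jac (e′V₀, ·)` at `U` (TRANSFER within the graph + the graph slice is a neighbourhood)
  have hι : Continuous fun z : GaugeField (F.P K) 0 (Matrix.specialUnitaryGroup (Fin 2) ℂ) =>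
      ((e' V₀, z) : GaugeField (F.P K) (K - J) (Matrix.specialUnitaryGroup (Fin 2) ℂ) × GaugeField (F.P K) 0 (Matrix.specialUnitaryGroup (Fin 2) ℂ)) :=
    continuous_const.prodMk continuous_id
  obtain ⟨htΦ, htJ⟩ := htransfer (e' V₀) U hVU (by rw [hΦU]; exact hUstrict)
  have hΦz : ContinuousAt (fun z => Φ (e' V₀, z)) U := by
    have hw : ContinuousWithinAt (fun z => Φ (e' V₀, z)) {z | ∀ c, (e' V₀) c ∈ T c z} U :=
      htΦ.comp hι.continuousWithinAt fun z hz => hz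
    exact hw.continuousAt hG
  have hJz : ContinuousAt (fun z => Jac (e' V₀, z)) U := by
    have hw : ContinuousWithinAt (fun z => Jac (e' V₀, z)) {z | ∀ c, (e' V₀) c ∈ T c z} U :=
      htJ.comp hι.continuousWithinAt fun z hz => hz
    exact hw.continuousAt hG
  have hΦS : {z | Φ (e' V₀, z) ∈ S} ∈ 𝓝 U := hΦz.preimage_mem_nhds (hSo.mem_nhds (by rw [hΦU]; exact hUS))
  refine ⟨?_, ?_, ?_⟩
  · -- (1) the live good leaves are a neighbourhood of `U`
    filter_upwards [hG, hΦS] with z hz hzS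
    exact ⟨(hJT _ _).2 hz, hzS⟩
  · -- (2) a.e. leaf in `N`: all coordinates interior (EDGE), hence continuity in the datum; the indicator is eventually `1`
    have hE : ∀ᵐ z ∂fieldMeasure (F.P K) 0 (Matrix.specialUnitaryGroup (Fin 2) ℂ), ∀ c, (e' V₀) c ∉ frontier (T c z) :=
      ae_all_iff.2 fun c => hedge c ((e' V₀) c)
    filter_upwards [hE] with z hzE hzN
    have hint : ∀ c, (e' V₀) c ∈ interior (T c z) := fun c => by
      rw [← self_sdiff_frontier]
      exact ⟨(hJT _ _).1 hzN.1 c, hzE c⟩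
    obtain ⟨hΦV, hJV⟩ := hreg (e' V₀) z hint
    have hΦV' : ContinuousAt (fun V : GaugeField (F.P J) 0 (Matrix.specialUnitaryGroup (Fin 2) ℂ) => Φ (e' V, z)) V₀ :=
      ContinuousAt.comp (f := e') (x := V₀) hΦV he'c.continuousAt
    have hJV' : ContinuousAt (fun V : GaugeField (F.P J) 0 (Matrix.specialUnitaryGroup (Fin 2) ℂ) => (Jac (e' V, z) : ℝ≥0∞)) V₀ :=
      ENNReal.continuous_coe.continuousAt.comp (ContinuousAt.comp (f := e') (x := V₀) hJV he'c.continuousAt)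
    have hev : ∀ᶠ V in 𝓝 V₀, Φ (e' V, z) ∈ S := hΦV'.preimage_mem_nhds (hSo.mem_nhds hzN.2)
    refine hJV'.congr ?_
    filter_upwards [hev] with V hV
    rw [Set.indicator_of_mem hV, Pi.one_apply, one_mul]
  · -- (3) continuity in the fine field at `U`
    have hJz' : ContinuousAt (fun z => (Jac (e' V₀, z) : ℝ≥0∞)) U := ENNReal.continuous_coe.continuousAt.comp hJz
    refine hJz'.congr ?_
    filter_upwards [hΦS] with z hz
    rw [Set.indicator_of_mem hz, Pi.one_apply, one_mul]

/-! ## §2 The knit: any window chart with the rows has, at every charted small-field history, the explicit chart's Jacobian value -/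

/-- ★★★ **ANY WINDOW CHART WITH THE ROWS HAS THE EXPLICIT CHART'S JACOBIAN VALUE AT EVERY CHARTED SMALL-FIELD HISTORY.**  Let `c : WindowChart F hJK S O` (`O` open,
measurable) satisfy the off-pivot identity on its live set and have a pivot-blind Jacobian (the `ChartRows`∕`ChartRowsJ` clauses; pivots `β`, in the tower `iterCentralBond (K−J)`), and let
`(Φ, Jac, T)` be fibred-chart data with §1's rows plus: the coarse fibre identity (`Jac ≠ 0 → Ū⁽ᴷ⁻ᴶ⁾ ∘ Φ = V`), the off-pivot identity on the windows, pivot-blindness of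
`Φ`∕`Jac`, measurability, and the transported LAW `μ_K⌊(D⁻¹O ∩ S) = ((μ_J⌊O ⊗ ν_K)·G′) ∘ Ψ′⁻¹` with `Ψ′ p = Φ (e′p.1, p.2)`, `G′ p = 1_S(Φ (e′p.1, p.2))·Jac (e′p.1, p.2)`
(✓`fibredLaw_transport`'s conclusion, with `descendTo = fieldShift hs ∘ Ū⁽ᴷ⁻ᴶ⁾`).  Then at every `V₀ ∈ O`, `U ∈ S` with `descendTo U = V₀`, live and self-charted for BOTH charts
with `c`'s four `ChartRows` clauses at `(V₀, U)`: `(c.jac (V₀, U) : ℝ≥0∞) = Jac (e′ V₀, U)`. [cite: Balaban1987RG1, (0.4) p.253 and (2.10) p.267] [cite: Bogachev2007, Thm 2.5.3] -/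
theorem windowChart_jac_eq_explicit_at {S : Set (GaugeField (F.P K) 0 (Matrix.specialUnitaryGroup (Fin 2) ℂ))}
    {O : Set (GaugeField (F.P J) 0 (Matrix.specialUnitaryGroup (Fin 2) ℂ))} (hO : MeasurableSet O) (hOo : IsOpen O)
    (c : Summit.QuantumFields.YangMills.Theorems.FluctuationComparisonRegPrIntLWregGlue.WindowChart F hJK S O) {κ : Type*} (β : κ → PBond (F.P K) 0)
    (hoff : ∀ V z, c.jac (V, z) ≠ 0 → ∀ b, (∀ k, β k ≠ b) → c.Φ (V, z) b = z b)
    (hjbl : ∀ V z (h : κ → Matrix.specialUnitaryGroup (Fin 2) ℂ), c.jac (V, extend β h z) = c.jac (V, z))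
    {Φ : GaugeField (F.P K) (K - J) (Matrix.specialUnitaryGroup (Fin 2) ℂ) × GaugeField (F.P K) 0 (Matrix.specialUnitaryGroup (Fin 2) ℂ) →
      GaugeField (F.P K) 0 (Matrix.specialUnitaryGroup (Fin 2) ℂ)}
    {Jac : GaugeField (F.P K) (K - J) (Matrix.specialUnitaryGroup (Fin 2) ℂ) × GaugeField (F.P K) 0 (Matrix.specialUnitaryGroup (Fin 2) ℂ) → ℝ≥0}
    {T : PBond (F.P K) (K - J) → GaugeField (F.P K) 0 (Matrix.specialUnitaryGroup (Fin 2) ℂ) → Set (Matrix.specialUnitaryGroup (Fin 2) ℂ)}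
    (hΦm : Measurable Φ) (hJm : Measurable Jac)
    (hfibA : ∀ V z, Jac (V, z) ≠ 0 → Averaging.iter (fun i => BlockAveraging.blockAvg (P := F.P K) (j := i) ℰp) (K - J) (Φ (V, z)) = V)
    (hJT : ∀ V z, Jac (V, z) ≠ 0 ↔ ∀ c, V c ∈ T c z)
    (hreg : ∀ V₀ z, (∀ c, V₀ c ∈ interior (T c z)) → ContinuousAt (fun V => Φ (V, z)) V₀ ∧ ContinuousAt (fun V => Jac (V, z)) V₀)
    (hedge : ∀ c (v : Matrix.specialUnitaryGroup (Fin 2) ℂ), ∀ᵐ z ∂fieldMeasure (F.P K) 0 (Matrix.specialUnitaryGroup (Fin 2) ℂ), v ∉ frontier (T c z))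
    (hchartedA : ∀ V z, (∀ c, V c ∈ T c z) → ∀ b, (∀ k, β k ≠ b) → Φ (V, z) b = z b)
    (hΦbl : ∀ V z (g : κ → Matrix.specialUnitaryGroup (Fin 2) ℂ), (∀ c, V c ∈ T c z) → Φ (V, extend β g z) = Φ (V, z))
    (hJbl : ∀ V z (g : κ → Matrix.specialUnitaryGroup (Fin 2) ℂ), Jac (V, extend β g z) = Jac (V, z))
    {Strict : Set (GaugeField (F.P K) 0 (Matrix.specialUnitaryGroup (Fin 2) ℂ))}
    (htransfer : ∀ (V : GaugeField (F.P K) (K - J) (Matrix.specialUnitaryGroup (Fin 2) ℂ)) (z₀ : GaugeField (F.P K) 0 (Matrix.specialUnitaryGroup (Fin 2) ℂ)),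
      (∀ c, V c ∈ T c z₀) → Φ (V, z₀) ∈ Strict →
        ContinuousWithinAt Φ {p : GaugeField (F.P K) (K - J) (Matrix.specialUnitaryGroup (Fin 2) ℂ) × GaugeField (F.P K) 0 (Matrix.specialUnitaryGroup (Fin 2) ℂ) |
            ∀ c, p.1 c ∈ T c p.2} (V, z₀) ∧
        ContinuousWithinAt Jac {p : GaugeField (F.P K) (K - J) (Matrix.specialUnitaryGroup (Fin 2) ℂ) × GaugeField (F.P K) 0 (Matrix.specialUnitaryGroup (Fin 2) ℂ) |
            ∀ c, p.1 c ∈ T c p.2} (V, z₀))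
    (hgraph : ∀ U₀ : GaugeField (F.P K) 0 (Matrix.specialUnitaryGroup (Fin 2) ℂ), U₀ ∈ Strict →
      {z : GaugeField (F.P K) 0 (Matrix.specialUnitaryGroup (Fin 2) ℂ) | ∀ c,
        Averaging.iter (fun i => BlockAveraging.blockAvg (P := F.P K) (j := i) ℰp) (K - J) U₀ c ∈ T c z} ∈ 𝓝 U₀)
    (hs : (F.PP F.m J).sitesPerDir 0 = (F.PP F.m K).sitesPerDir (K - J))
    (hdesc : (descendTo F ℰp J K hJK : GaugeField (F.P K) 0 (Matrix.specialUnitaryGroup (Fin 2) ℂ) → GaugeField (F.P J) 0 (Matrix.specialUnitaryGroup (Fin 2) ℂ)) =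
      fieldShift hs ∘ Averaging.iter (fun i => BlockAveraging.blockAvg (P := F.P K) (j := i) ℰp) (K - J))
    (hSm : MeasurableSet S) (hSo : IsOpen S) (hSstrict : S ⊆ Strict)
    (hlaw' : (fieldMeasure (F.P K) 0 (Matrix.specialUnitaryGroup (Fin 2) ℂ)).restrict (descendTo F ℰp J K hJK ⁻¹' O ∩ S) =
      ((((fieldMeasure (F.P J) 0 (Matrix.specialUnitaryGroup (Fin 2) ℂ)).restrict O).prod (fieldMeasure (F.P K) 0 (Matrix.specialUnitaryGroup (Fin 2) ℂ))).withDensity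
        fun p => S.indicator (1 : GaugeField (F.P K) 0 (Matrix.specialUnitaryGroup (Fin 2) ℂ) → ℝ≥0∞) (Φ (fieldShift hs.symm p.1, p.2)) *
          (Jac (fieldShift hs.symm p.1, p.2) : ℝ≥0∞)).map fun p => Φ (fieldShift hs.symm p.1, p.2))
    {V₀ : GaugeField (F.P J) 0 (Matrix.specialUnitaryGroup (Fin 2) ℂ)} (hV₀ : V₀ ∈ O)
    {U : GaugeField (F.P K) 0 (Matrix.specialUnitaryGroup (Fin 2) ℂ)} (hUS : U ∈ S)
    (hUV : Averaging.iter (fun i => BlockAveraging.blockAvg (P := F.P K) (j := i) ℰp) (K - J) U = fieldShift hs.symm V₀)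
    (hJU : Jac (fieldShift hs.symm V₀, U) ≠ 0) (hΦU' : Φ (fieldShift hs.symm V₀, U) = U)
    (hcarr : {z | c.jac (V₀, z) ≠ 0} ∈ 𝓝 U) (hΦU : c.Φ (V₀, U) = U)
    (hrel : IsOpen ((Subtype.val : {z | c.jac (V₀, z) ≠ 0} → GaugeField (F.P K) 0 (Matrix.specialUnitaryGroup (Fin 2) ℂ)) ⁻¹' {z | c.Φ (V₀, z) ∈ S}))
    (hcz : ContinuousOn (fun z => (c.jac (V₀, z) : ℝ)) {z | c.jac (V₀, z) ≠ 0}) :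
    (c.jac (V₀, U) : ℝ≥0∞) = Jac (fieldShift hs.symm V₀, U) := by
  set e' : GaugeField (F.P J) 0 (Matrix.specialUnitaryGroup (Fin 2) ℂ) → GaugeField (F.P K) (K - J) (Matrix.specialUnitaryGroup (Fin 2) ℂ) :=
    fieldShift hs.symm with he'_def
  set M := ((fieldMeasure (F.P J) 0 (Matrix.specialUnitaryGroup (Fin 2) ℂ)).restrict O).prod
        (fieldMeasure (F.P K) 0 (Matrix.specialUnitaryGroup (Fin 2) ℂ)) with hM
  set G' : GaugeField (F.P J) 0 (Matrix.specialUnitaryGroup (Fin 2) ℂ) × GaugeField (F.P K) 0 (Matrix.specialUnitaryGroup (Fin 2) ℂ) → ℝ≥0∞ :=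
    fun p => S.indicator (1 : GaugeField (F.P K) 0 (Matrix.specialUnitaryGroup (Fin 2) ℂ) → ℝ≥0∞) (Φ (e' p.1, p.2)) * (Jac (e' p.1, p.2) : ℝ≥0∞) with hG'_def
  have he' : Measurable e' := measurable_fieldShift hs.symm
  have hθ : Measurable fun p : GaugeField (F.P J) 0 (Matrix.specialUnitaryGroup (Fin 2) ℂ) × GaugeField (F.P K) 0 (Matrix.specialUnitaryGroup (Fin 2) ℂ) =>
      ((e' p.1, p.2) : GaugeField (F.P K) (K - J) (Matrix.specialUnitaryGroup (Fin 2) ℂ) × GaugeField (F.P K) 0 (Matrix.specialUnitaryGroup (Fin 2) ℂ)) :=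
    (he'.comp measurable_fst).prodMk measurable_snd
  have hΨ'm : Measurable fun p : GaugeField (F.P J) 0 (Matrix.specialUnitaryGroup (Fin 2) ℂ) × GaugeField (F.P K) 0 (Matrix.specialUnitaryGroup (Fin 2) ℂ) =>
      Φ (e' p.1, p.2) := hΦm.comp hθ
  have hG'm : Measurable G' :=
    ((measurable_one.indicator hSm).comp hΨ'm).mul (hJm.comp hθ).coe_nnreal_ennreal
  have hDm : Measurable (descendTo F ℰp J K hJK) := measurable_descendTo F ℰp measurableE_ℰp hJK
  have hee' : ∀ V, fieldShift hs (e' V) = V := fieldShift_symm_fieldShift hs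
  -- `G′ ≠ 0` forces liveness of `Jac` at the shifted datum
  have hlive : ∀ p : GaugeField (F.P J) 0 (Matrix.specialUnitaryGroup (Fin 2) ℂ) × GaugeField (F.P K) 0 (Matrix.specialUnitaryGroup (Fin 2) ℂ),
      G' p ≠ 0 → Jac (e' p.1, p.2) ≠ 0 := fun p hp hJ0 => hp (by
    show S.indicator (1 : GaugeField (F.P K) 0 (Matrix.specialUnitaryGroup (Fin 2) ℂ) → ℝ≥0∞) (Φ (e' p.1, p.2)) * (Jac (e' p.1, p.2) : ℝ≥0∞) = 0
    rw [hJ0, ENNReal.coe_zero, mul_zero])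
  -- the explicit side's law rows
  have hfib' : ∀ᵐ p ∂M, G' p ≠ 0 → descendTo F ℰp J K hJK (Φ (e' p.1, p.2)) = p.1 :=
    Filter.Eventually.of_forall fun p hp => by
      rw [hdesc, Function.comp_apply, hfibA _ _ (hlive p hp)]
      exact hee' p.1
  have hpiv' : ∀ᵐ p ∂M, G' p ≠ 0 → ∃ h : κ → Matrix.specialUnitaryGroup (Fin 2) ℂ,
      Φ (e' p.1, p.2) = extend β h p.2 :=
    Filter.Eventually.of_forall fun p hp => by
      have hw : ∀ c, (e' p.1) c ∈ T c p.2 := (hJT _ _).1 (hlive p hp)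
      refine ⟨fun k => Φ (e' p.1, p.2) (β k), ?_⟩
      funext b
      by_cases hb : ∃ k, β k = b
      · classical
        rw [Function.extend_def, dif_pos hb]
        exact congrArg (Φ (e' p.1, p.2)) (Classical.choose_spec hb).symm
      · rw [extend_apply' _ _ _ hb]
        exact hchartedA _ _ hw b fun k hk => hb ⟨k, hk⟩
  have hGbl : ∀ (h : κ → Matrix.specialUnitaryGroup (Fin 2) ℂ)
      (p : GaugeField (F.P J) 0 (Matrix.specialUnitaryGroup (Fin 2) ℂ) × GaugeField (F.P K) 0 (Matrix.specialUnitaryGroup (Fin 2) ℂ)),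
      G' (p.1, extend β h p.2) = G' p := by
    intro h p
    show S.indicator (1 : GaugeField (F.P K) 0 (Matrix.specialUnitaryGroup (Fin 2) ℂ) → ℝ≥0∞) (Φ (e' p.1, extend β h p.2)) *
        (Jac (e' p.1, extend β h p.2) : ℝ≥0∞) =
      S.indicator (1 : GaugeField (F.P K) 0 (Matrix.specialUnitaryGroup (Fin 2) ℂ) → ℝ≥0∞) (Φ (e' p.1, p.2)) * (Jac (e' p.1, p.2) : ℝ≥0∞)
    rw [hJbl]
    by_cases hw : ∀ c, (e' p.1) c ∈ T c p.2
    · rw [hΦbl _ _ h hw]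
    · have hJ0 : Jac (e' p.1, p.2) = 0 := by
        by_contra hne
        exact hw ((hJT _ _).1 hne)
      rw [hJ0, ENNReal.coe_zero, mul_zero, mul_zero]
  -- c's law rows (its own structure fields)
  have hO' : ∀ᵐ p ∂M, p.1 ∈ O := by
    have hset : MeasurableSet {p : GaugeField (F.P J) 0 (Matrix.specialUnitaryGroup (Fin 2) ℂ) ×
        GaugeField (F.P K) 0 (Matrix.specialUnitaryGroup (Fin 2) ℂ) | p.1 ∈ O} := measurable_fst hO
    refine (Measure.ae_prod_iff_ae_ae hset).2 ?_
    filter_upwards [ae_restrict_mem hO] with V hV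
    exact Filter.Eventually.of_forall fun _ => hV
  have hfib : ∀ᵐ p ∂M, (c.jac p : ℝ≥0∞) ≠ 0 → descendTo F ℰp J K hJK (c.Φ p) = p.1 := by
    filter_upwards [hO'] with p hp hj
    exact c.descendTo_Φ p.1 hp p.2 (by exact_mod_cast hj)
  have hpiv : ∀ᵐ p ∂M, (c.jac p : ℝ≥0∞) ≠ 0 → ∃ h : κ → Matrix.specialUnitaryGroup (Fin 2) ℂ,
      c.Φ p = extend β h p.2 := by
    refine Filter.Eventually.of_forall fun p hj => ⟨fun k => c.Φ p (β k), ?_⟩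
    have hj' : c.jac (p.1, p.2) ≠ 0 := by exact_mod_cast hj
    funext b
    by_cases hb : ∃ k, β k = b
    · classical
      rw [Function.extend_def, dif_pos hb]
      exact congrArg (c.Φ p) (Classical.choose_spec hb).symm
    · rw [extend_apply' _ _ _ hb]
      exact hoff p.1 p.2 hj' b fun k hk => hb ⟨k, hk⟩
  have hfin : ∫⁻ p, (c.jac p : ℝ≥0∞) ∂M ≠ ∞ := by
    refine ne_top_of_le_ne_top ?_ (lintegral_mono fun p => ENNReal.coe_le_coe.2 (c.jac_le p))
    rw [lintegral_const]
    exact ENNReal.mul_ne_top ENNReal.coe_ne_top (measure_ne_top M _)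
  -- a.e. identification (✓brick 2)
  have hae : (fun p => (c.jac p : ℝ≥0∞)) =ᵐ[M] G' :=
    ae_eq_of_two_laws hDm β c.measurable_Φ hΨ'm c.measurable_jac.coe_nnreal_ennreal hG'm c.map_Φ hlaw' hfib hpiv hfib' hpiv'
      (fun h p => by exact_mod_cast hjbl p.1 p.2 h) hGbl hfin
  -- the point rows of `G′` (§1) and the point (✓brick 3, local edition)
  obtain ⟨hN, hGV, hGz⟩ := explicit_pointRows F hJT hreg hedge htransfer hgraph hs hSo hSstrict hUS hUV hJU hΦU'
  have h := windowChart_jac_eq_at_local F hJK hOo c hG'm hae hV₀ hUS hcarr hΦU hrel hcz hN hGV hGz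
  rw [h]
  show S.indicator (1 : GaugeField (F.P K) 0 (Matrix.specialUnitaryGroup (Fin 2) ℂ) → ℝ≥0∞) (Φ (e' V₀, U)) * (Jac (e' V₀, U) : ℝ≥0∞) = Jac (e' V₀, U)
  rw [hΦU', Set.indicator_of_mem hUS, Pi.one_apply, one_mul]

end Summit.QuantumFields.YangMills.Theorems.FluctuationComparisonRegPrIntLS2BetaChartJacExplicitPointRows

end
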